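import Summits.Parity.GeneralizedHardyLittlewood.Theorems.PrimeLevelFamEdgeMomentsBeyondDiagonalFirstOrderOffDiagHeights
import HarnessLib

/-!
# The height-integrated off-diagonal of the order-`k` twisted first moment
# (helper for crux K_A `PrimeLevelFamEdge.MomentsBeyondDiagonal`, stmt-Parity-20007, stub `stub_first : SubFirst` ∀`Q`)

After the unbalanced split (`…FirstOrderUnbalanced` §4) the off-diagonal of `Σʰ λ_f(m)Λ^{(k)}(f,½)` is
`Σ_n √n J_N(m,n) I_k(n,y)`, `I_k(n,y) = ∫_y^∞ e^{−2πnv}(log √N v)^k dv`, `y = 1/(mN²)`. Here: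
* §1 `sqrt_mul_axisWeight_eq`: per term, by parts, `√n I_k(n,a) = (2π)⁻¹ n^{−1/2}[e^{−2πna}(log √N a)^k + I′_k(n,a)]`,
  `I′_k(n,a) = ∫_a^∞ e^{−2πnv} k(log √N v)^{k−1}v⁻¹ dv`;
* §2 `tsum_petJ_weight_integral_eq`: the exchange `Σ_n n^{−1/2}J(m,n) I′_k(n,y) = ∫_y^∞ k(log √N t)^{k−1}t⁻¹ · OD_t(m) dt`
  (`OD_t(m) = Σ_n n^{−1/2}e^{−2πnt}J(m,n)`, dominated by Weil's bound and `Σ n rⁿ`);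
so that the off-diagonal is `(2π)⁻¹[(log √N y)^k OD_y(m) + ∫_y^∞ k(log √N t)^{k−1}t⁻¹ OD_t(m) dt]`, ready for the height
bounds of `…FirstOrderOffDiagHeights`. Proof only; no definition; nothing about Landau–Siegel zeros; K_A NOT proved.
-/

noncomputable section

open scoped Real
open Complex Set MeasureTheory Filter Topology Finset CongruenceSubgroup
open Literature.NumberTheory.EllipticCurves.ModularForms
open Literature.NumberTheory.LFunctions Literature.NumberTheory.LFunctions.KMV2000
open Literature.NumberTheory.LFunctions.KowalskiMichel2000

namespace Summit.Parity.GeneralizedHardyLittlewood.Theorems.MomentsBeyondDiagonal.FirstOrderAFE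

variable {N : ℕ} [NeZero N]

/-! ## §1. Integration by parts, per term -/

/-- **Per-term integration by parts** (`n ≥ 1`, `a > 0`): `√n ∫_a^∞ e^{−2πnv}(log √N v)^k dv =
(2π)⁻¹ (n^{−1/2} e^{−2πna}) (log √N a)^k + (2π)⁻¹ n^{−1/2} ∫_a^∞ e^{−2πnv} k(log √N v)^{k−1}v⁻¹ dv`.
[cite: Bettin2017, §2 (2.1)–(2.3)] -/
theorem sqrt_mul_axisWeight_eq {n : ℕ} (hn : 1 ≤ n) {a : ℝ} (ha : 0 < a) (k : ℕ) :
    Real.sqrt n * ∫ v in Ioi a, Real.exp (-(2 * Real.pi * n) * v) * (Real.log (Real.sqrt N * v)) ^ k =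
      (2 * π)⁻¹ * (((n : ℝ) ^ (-(1 / 2 : ℝ)) * Real.exp (-(2 * π * n) * a)) * (Real.log (Real.sqrt N * a)) ^ k) +
        (2 * π)⁻¹ * (n : ℝ) ^ (-(1 / 2 : ℝ)) *
          ∫ v in Ioi a, Real.exp (-(2 * Real.pi * n) * v) * ((k : ℝ) * (Real.log (Real.sqrt N * v)) ^ (k - 1) * v⁻¹) := by
  have hn0 : (0 : ℝ) < n := by exact_mod_cast hn
  have hn1 : (1 : ℝ) ≤ n := by exact_mod_cast hn
  have hc : 2 * π ≤ 2 * π * n := le_mul_of_one_le_right (by positivity) hn1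
  have hparts := integral_exp_mul_logPow_parts (N := N) hc k ha
  simp only [neg_mul] at hparts ⊢
  have hsqrt : Real.sqrt n = (n : ℝ) ^ (-(1 / 2 : ℝ)) * n := by
    rw [Real.sqrt_eq_rpow, show (-(1 / 2 : ℝ)) = (1 / 2 : ℝ) - 1 by norm_num, Real.rpow_sub_one hn0.ne',
      div_mul_cancel₀ _ hn0.ne']
  have hπ : (2 * π : ℝ) ≠ 0 := by positivity
  set I := ∫ v in Ioi a, Real.exp (-(2 * Real.pi * n * v)) * (Real.log (Real.sqrt N * v)) ^ k with hI
  set I' := ∫ v in Ioi a, Real.exp (-(2 * Real.pi * n * v)) *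
    ((k : ℝ) * (Real.log (Real.sqrt N * v)) ^ (k - 1) * v⁻¹) with hI'
  have hI2 : I = (2 * π * n)⁻¹ * (Real.exp (-(2 * π * n * a)) * (Real.log (Real.sqrt N * a)) ^ k + I') := by
    rw [← hparts, ← mul_assoc, inv_mul_cancel₀ (by positivity), one_mul]
  rw [hsqrt, hI2]
  field_simp

/-! ## §2. The exchange of the `n`-sum with the height integral -/

omit [NeZero N] in
/-- The derivative weight is dominated on `t ≥ y > 0`: `|k (log √N t)^{k−1} t⁻¹| ≤ k y⁻¹ |log √N t|^{k−1}`. -/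
theorem abs_derivWeight_le (k : ℕ) {y t : ℝ} (hy : 0 < y) (hyt : y ≤ t) :
    |(k : ℝ) * (Real.log (Real.sqrt N * t)) ^ (k - 1) * t⁻¹| ≤ (k : ℝ) * y⁻¹ * |Real.log (Real.sqrt N * t)| ^ (k - 1) := by
  have ht : 0 < t := lt_of_lt_of_le hy hyt
  rw [abs_mul, abs_mul, abs_of_nonneg (Nat.cast_nonneg k), abs_pow, abs_of_pos (inv_pos.mpr ht)]
  have hinv : t⁻¹ ≤ y⁻¹ := inv_anti₀ hy hyt
  calc (k : ℝ) * |Real.log (Real.sqrt N * t)| ^ (k - 1) * t⁻¹ ≤ (k : ℝ) * |Real.log (Real.sqrt N * t)| ^ (k - 1) * y⁻¹ := by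
        gcongr
    _ = _ := by ring

/-- **The exchange.** For `N` prime, `m ≥ 1`, `y > 0`, `k`: the series `Σ_n n^{−1/2} J(m,n) I′_k(n,y)` converges and equals
`∫_y^∞ k(log √N t)^{k−1}t⁻¹ · (Σ_n n^{−1/2}e^{−2πnt}J(m,n)) dt` (dominated exchange: Weil's bound `‖J(m,n)‖ ≤ K m n`,
`e^{−2πnt} ≤ e^{−2πny}e^{−2π(t−y)}`, `Σ n rⁿ < ∞`). [cite: Bettin2017, §2 (2.3)–(2.4)] -/
theorem tsum_petJ_weight_integral_eq (hN : N.Prime) {m : ℕ} (hm : 1 ≤ m) {y : ℝ} (hy : 0 < y) (k : ℕ) :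
    Summable (fun n : ℕ ↦ petJ N m n * (((n : ℝ) ^ (-(1 / 2 : ℝ)) : ℝ) : ℂ) *
        ((∫ v in Ioi y, Real.exp (-(2 * Real.pi * n) * v) * ((k : ℝ) * (Real.log (Real.sqrt N * v)) ^ (k - 1) * v⁻¹) : ℝ) : ℂ)) ∧
    ∑' n : ℕ, petJ N m n * (((n : ℝ) ^ (-(1 / 2 : ℝ)) : ℝ) : ℂ) *
        ((∫ v in Ioi y, Real.exp (-(2 * Real.pi * n) * v) * ((k : ℝ) * (Real.log (Real.sqrt N * v)) ^ (k - 1) * v⁻¹) : ℝ) : ℂ) =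
      ∫ t in Ioi y, (((k : ℝ) * (Real.log (Real.sqrt N * t)) ^ (k - 1) * t⁻¹ : ℝ) : ℂ) *
        ∑' n : ℕ, (((n : ℝ) ^ (-(1 / 2 : ℝ)) * Real.exp (-(2 * π * n) * t) : ℝ) : ℂ) * petJ N m n := by
  obtain ⟨K, hK0, hK⟩ := norm_petJ_le_all
  have hN0 : (0 : ℝ) < N := by exact_mod_cast hN.pos
  have hN1 : (1 : ℝ) ≤ N := by exact_mod_cast hN.one_lt.le
  have hm1 : (1 : ℝ) ≤ m := by exact_mod_cast hm
  have hm0 : (0 : ℝ) < m := by linarith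
  have hs : 0 < Real.sqrt N := Real.sqrt_pos.mpr hN0
  -- the derivative weight and the terms
  set φ : ℝ → ℝ := fun t ↦ (k : ℝ) * (Real.log (Real.sqrt N * t)) ^ (k - 1) * t⁻¹ with hφ
  set F : ℕ → ℝ → ℂ := fun n t ↦ petJ N m n * (((n : ℝ) ^ (-(1 / 2 : ℝ)) : ℝ) : ℂ) *
    ((Real.exp (-(2 * Real.pi * n) * t) * φ t : ℝ) : ℂ) with hF
  -- sizes: `r = e^{-2πy} < 1`, the majorant `G(t) = e^{-2πt}|log √N t|^{k-1}` and its integral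
  set r : ℝ := Real.exp (-(2 * π * y)) with hr
  have hr0 : 0 < r := Real.exp_pos _
  have hr1 : r < 1 := Real.exp_lt_one_iff.mpr (by nlinarith [Real.pi_pos])
  have hrn : ‖r‖ < 1 := by rw [Real.norm_of_nonneg hr0.le]; exact hr1
  have hGint : IntegrableOn (fun t : ℝ ↦ Real.exp (-(2 * π * t)) * |Real.log (Real.sqrt N * t)| ^ (k - 1)) (Ioi y) :=
    integrableOn_exp_abs_logPow_Ioi (N := N) (k - 1) hy.le
  set KG : ℝ := ∫ t in Ioi y, Real.exp (-(2 * π * t)) * |Real.log (Real.sqrt N * t)| ^ (k - 1) with hKG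
  have hKG0 : 0 ≤ KG := setIntegral_nonneg measurableSet_Ioi fun t _ ↦ by positivity
  -- Weil: `‖J(m,n)‖ ≤ K m² n`
  have hJ : ∀ n : ℕ, ‖petJ N m n‖ ≤ K * m ^ 2 * n := by
    intro n
    refine (hK N hN m n hm).trans ?_
    have hn0 : (0 : ℝ) ≤ n := Nat.cast_nonneg n
    have hg : Real.sqrt ((m.gcd n : ℕ) : ℝ) ≤ m := by
      have hle : ((m.gcd n : ℕ) : ℝ) ≤ m := by
        rcases Nat.eq_zero_or_pos n with rfl | hn
        · simp
        · exact_mod_cast Nat.gcd_le_left n hm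
      calc Real.sqrt ((m.gcd n : ℕ) : ℝ) ≤ Real.sqrt ((m : ℝ) ^ 2) := Real.sqrt_le_sqrt (by nlinarith)
        _ = m := Real.sqrt_sq hm0.le
    have hmn : Real.sqrt ((m : ℝ) * n) ≤ (m : ℝ) * n := by
      rcases Nat.eq_zero_or_pos n with rfl | hn
      · simp
      · have hn1 : (1 : ℝ) ≤ n := by exact_mod_cast hn
        rw [Real.sqrt_le_left (by positivity)]
        have h1 : (1 : ℝ) ≤ (m : ℝ) * n := by nlinarith
        nlinarith
    have hNp : (N : ℝ) ^ (-(3 / 2 : ℝ)) ≤ 1 := Real.rpow_le_one_of_one_le_of_nonpos hN1 (by norm_num)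
    calc K * Real.sqrt ((m.gcd n : ℕ) : ℝ) * Real.sqrt ((m : ℝ) * n) * (N : ℝ) ^ (-(3 / 2 : ℝ))
        ≤ K * m * ((m : ℝ) * n) * 1 := by gcongr
      _ = K * m ^ 2 * n := by ring
  -- pointwise domination on `t > y`: `‖F n t‖ ≤ (K m² n rⁿ)(k y⁻¹ e^{2πy}) · G(t)`
  have hdom : ∀ n : ℕ, ∀ t ∈ Ioi y,
      ‖F n t‖ ≤ (K * m ^ 2 * (n * r ^ n)) * ((k : ℝ) * y⁻¹ * Real.exp (2 * π * y)) *
        (Real.exp (-(2 * π * t)) * |Real.log (Real.sqrt N * t)| ^ (k - 1)) := by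
    intro n t ht
    have ht : y < t := ht
    have ht0 : 0 < t := hy.trans ht
    rcases Nat.eq_zero_or_pos n with rfl | hn
    · simp only [hF, Nat.cast_zero, Real.zero_rpow (by norm_num : (-(1 / 2 : ℝ)) ≠ 0), Complex.ofReal_zero,
        mul_zero, zero_mul, norm_zero]
      positivity
    have hn1 : (1 : ℝ) ≤ n := by exact_mod_cast hn
    have hn0 : (0 : ℝ) < n := by linarith
    -- `n^{-1/2} ≤ 1`
    have hnp : (n : ℝ) ^ (-(1 / 2 : ℝ)) ≤ 1 := Real.rpow_le_one_of_one_le_of_nonpos hn1 (by norm_num)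
    have hnp0 : 0 ≤ (n : ℝ) ^ (-(1 / 2 : ℝ)) := Real.rpow_nonneg hn0.le _
    -- `e^{-2πnt} ≤ rⁿ e^{2πy} e^{-2πt}`
    have hexp : Real.exp (-(2 * Real.pi * n) * t) ≤ r ^ n * Real.exp (2 * π * y) * Real.exp (-(2 * π * t)) := by
      rw [hr, ← Real.exp_nat_mul, ← Real.exp_add, ← Real.exp_add]
      refine Real.exp_le_exp.mpr ?_
      have : 0 ≤ ((n : ℝ) - 1) * (t - y) := mul_nonneg (by linarith) (by linarith)
      nlinarith [Real.pi_pos]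
    have hφ' := abs_derivWeight_le (N := N) k hy ht.le
    simp only [hF]
    rw [norm_mul, norm_mul, Complex.norm_real, Complex.norm_real, Real.norm_of_nonneg hnp0, Real.norm_eq_abs, abs_mul,
      Real.abs_exp]
    calc ‖petJ N m n‖ * (n : ℝ) ^ (-(1 / 2 : ℝ)) * (Real.exp (-(2 * Real.pi * n) * t) * |φ t|)
        ≤ (K * m ^ 2 * n) * 1 * ((r ^ n * Real.exp (2 * π * y) * Real.exp (-(2 * π * t))) *
            ((k : ℝ) * y⁻¹ * |Real.log (Real.sqrt N * t)| ^ (k - 1))) := by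
          gcongr
          exact hJ n
      _ = _ := by ring
  -- integrability of each term on `Ioi y`
  have hφ_cont : ContinuousOn φ (Ioi y) := by
    have hlog : ContinuousOn (fun t : ℝ ↦ Real.log (Real.sqrt N * t)) (Ioi y) :=
      Real.continuousOn_log.comp (by fun_prop) fun t ht ↦ (mul_pos hs (hy.trans ht)).ne'
    exact (continuousOn_const.mul (hlog.pow (k - 1))).mul (continuousOn_inv₀.mono fun t ht ↦ (hy.trans ht).ne')
  have hF_cont : ∀ n : ℕ, ContinuousOn (F n) (Ioi y) := by
    intro n
    simp only [hF]
    refine continuousOn_const.mul (Complex.continuous_ofReal.comp_continuousOn ((Continuous.continuousOn ?_).mul hφ_cont))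
    fun_prop
  have hF_int : ∀ n : ℕ, Integrable (F n) (volume.restrict (Ioi y)) := by
    intro n
    have hmaj := hGint.const_mul ((K * m ^ 2 * (n * r ^ n)) * ((k : ℝ) * y⁻¹ * Real.exp (2 * π * y)))
    refine Integrable.mono' hmaj ((hF_cont n).aestronglyMeasurable measurableSet_Ioi) ?_
    exact (ae_restrict_iff' measurableSet_Ioi).mpr (Filter.Eventually.of_forall fun t ht ↦ hdom n t ht)
  -- summability of `n ↦ ∫ ‖F n‖`
  have hF_norm : ∀ n : ℕ, ∫ t in Ioi y, ‖F n t‖ ≤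
      (K * m ^ 2 * ((k : ℝ) * y⁻¹ * Real.exp (2 * π * y)) * KG) * (n * r ^ n) := by
    intro n
    have hmaj := hGint.const_mul ((K * m ^ 2 * (n * r ^ n)) * ((k : ℝ) * y⁻¹ * Real.exp (2 * π * y)))
    calc ∫ t in Ioi y, ‖F n t‖
        ≤ ∫ t in Ioi y, (K * m ^ 2 * (n * r ^ n)) * ((k : ℝ) * y⁻¹ * Real.exp (2 * π * y)) *
            (Real.exp (-(2 * π * t)) * |Real.log (Real.sqrt N * t)| ^ (k - 1)) :=
          setIntegral_mono_on (hF_int n).norm hmaj measurableSet_Ioi fun t ht ↦ hdom n t ht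
      _ = (K * m ^ 2 * ((k : ℝ) * y⁻¹ * Real.exp (2 * π * y)) * KG) * (n * r ^ n) := by
          rw [integral_const_mul, hKG]; ring
  have hgeom : Summable (fun n : ℕ ↦ (K * m ^ 2 * ((k : ℝ) * y⁻¹ * Real.exp (2 * π * y)) * KG) * (n * r ^ n)) :=
    (hasSum_coe_mul_geometric_of_norm_lt_one hrn).summable.mul_left _
  have hF_sum : Summable (fun n : ℕ ↦ ∫ t in Ioi y, ‖F n t‖) :=
    Summable.of_nonneg_of_le (fun n ↦ integral_nonneg fun t ↦ norm_nonneg _) hF_norm hgeom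
  -- the exchange
  have hex := hasSum_integral_of_summable_integral_norm hF_int hF_sum
  -- identify the terms: `∫ F n = J(m,n) n^{-1/2} I'_k(n,y)`
  have hterm : ∀ n : ℕ, ∫ t in Ioi y, F n t = petJ N m n * (((n : ℝ) ^ (-(1 / 2 : ℝ)) : ℝ) : ℂ) *
      ((∫ v in Ioi y, Real.exp (-(2 * Real.pi * n) * v) *
        ((k : ℝ) * (Real.log (Real.sqrt N * v)) ^ (k - 1) * v⁻¹) : ℝ) : ℂ) := by
    intro n
    simp only [hF]
    rw [integral_const_mul, integral_complex_ofReal]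
  -- identify the sum: `Σ_n F n t = φ(t) · OD_t(m)`
  have hsumt : ∀ t : ℝ, ∑' n : ℕ, F n t = ((φ t : ℝ) : ℂ) *
      ∑' n : ℕ, (((n : ℝ) ^ (-(1 / 2 : ℝ)) * Real.exp (-(2 * π * n) * t) : ℝ) : ℂ) * petJ N m n := by
    intro t
    rw [← tsum_mul_left]
    refine tsum_congr fun n ↦ ?_
    simp only [hF]
    push_cast
    ring
  refine ⟨?_, ?_⟩
  · have h := hex.summable
    simp_rw [hterm] at h
    exact h
  · have h := hex.tsum_eq
    simp_rw [hterm, hsumt] at h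
    exact h

end Summit.Parity.GeneralizedHardyLittlewood.Theorems.MomentsBeyondDiagonal.FirstOrderAFE

end
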